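import Summits.BirchSwinnertonDyer.BirchSwinnertonDyer.Theorems.ThetaPartnerAtTwoSignedKatoUpToAtTwoLocalTwoPlusPoints
import Summits.BirchSwinnertonDyer.BirchSwinnertonDyer.Theorems.ThetaPartnerAtTwoSignedControlAtTwoPlusLayerTwoPoints
import HarnessLib

/-!
# Route `ThetaPartnerAtTwo` (TP2), crux K3 `SignedKatoDivisibilityUpToAtTwo` (item stmt-BirchSwinnertonDyer-20308),
# line `colemanrat` v3 — THE LOCAL THEORY AT `p = 2`, file 13: the `ℤ₂`-tower points `d_n` READ IN KOBAYASHI'S LAYER CURRENCY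
# `E(ℚ_{2,n}) = localLayerPointsOfEmb κ ι W n` for the CYCLOTOMIC `κ`: clauses (L), (TR) and (GEN₀)-nondivisibility of the plus
# Honda system HONDA⁺@2 (K4's registered `stub_plusHondaSystemTwo`), for every embedding `ι : ℚ̄ → ℚ̄₂`

HONEST FRAMING (cell `bsd-wall`, lead `bsd-wall-tp2-p2x` g3): THEOREMS ONLY — no definition, no named fact, no instance, no
`sorry`; nothing about any Selmer group is asserted; closes no item; BSD is NOT proved by any of this.

## What

File 12 (`…LocalTwoPlusPoints`) built, for `W/ℚ` globally minimal with `GoodSS W 2`, `a₂(W) = 0`, the points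
`d_n = 3 • (c_{n+2} + σ_{n+2} • c_{n+2}) − 2 • c_1 ∈ localPoints W ℚ_[2]` (Kobayashi tower points `c_m`, `Λ(c_m) = ℓ_m`;
inverters `σ_m ζ_{2^m} = ζ_{2^m}⁻¹`), fixed by `Stab ζ_{2^{n+2}}` and by every inverter of `ζ_{2^{n+2}}`, with the EXACT trace
relation `∑_{Stab ζ_{2^{n+3}}/Stab ζ_{2^{n+4}}} q̃ • d_{n+2} = −d_n` and `d_0 ≠ 2 • b` for `Γ`-fixed `b`. The K4 width seat's dictionary
(`…SignedControlAtTwoPlusLayerTwoPoints`: `SignedEC.PlusLayer.mem_localLayerPointsOfEmb_two_iff_stab`,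
`SignedEC.PlusLayer.localTraceOfEmb_two_eq_sum_stab`) identifies, for the CYCLOTOMIC `κ : ZpExtension ℚ 2` and ANY
`ι : ℚ̄ → ℚ̄₂`, the layer-`n` points `localLayerPointsOfEmb κ ι W n = E(ℚ_{2,n})` with the `⟨Stab ζ_{2^{n+2}}, σ⟩`-fixed points and
the layer trace `localTraceOfEmb κ ι W m n` with that coset sum. THIS FILE composes the two:
* `plusPointsLayer_two`: for every such `W`, `κ`, `ι` there are `c`, `σ`, `d` (displayed: tower-point data of `c`, inverters `σ`,
  `d n = 3 • (c (n+2) + σ (n+2) • c (n+2)) − 2 • c 1`) with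
  (L) `∀ m, d m ∈ localLayerPointsOfEmb κ ι W m`, (TR) `∀ m, localTraceOfEmb κ ι W (m+1) (m+2) (d (m+2)) = −d m`,
  (NONDIV) `∀ b ∈ localLayerPointsOfEmb κ ι W 0, d 0 ≠ 2 • b` — three of the four clauses of the hypothesis of
  `SignedEC.stub_plusHondaSystemTwo_of_padic_nonDiv` (p589060), VERBATIM; the fourth, (GEN) for `m ≥ 1`, is the K4 lead's
  tower lemma + Prop. 8.11⁺ at `2` for the same `d` (it is insensitive to the unit `3` and to the `E(ℚ₂)`-shift `2c_1`).
* `plusPointsLayer_two_clauses`: the same with `c`, `σ` hidden (∃ `d` only).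

References: [Kobayashi2003] Def. 1.1, §8.4, Lemma 8.9, Prop. 8.12; [KuriharaOtsuki2006] §1.3, Prop. 1.4, p. 557; [Sprung2012]
Thm. 2.2 (2′) (p. 1487); [Washington1997] §13.1.
-/

set_option autoImplicit false
-- the Theorems namespace of this sub repeats the summit name by design (D-0017 nested layout)
set_option linter.dupNamespace false

noncomputable section

open scoped Classical

namespace Summit.BirchSwinnertonDyer.BirchSwinnertonDyer.Theorems

namespace SignedKatoOffTwo.LocalTwo

open WeierstrassCurve Field
open Summit.BirchSwinnertonDyer.Rank1Residual.Additive
open Summit.BirchSwinnertonDyer.Rank1Residual.Additive.PadicCyclotomicTower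
open Summit.BirchSwinnertonDyer.Rank1Residual.Additive.BallEval
open Summit.BirchSwinnertonDyer.BirchSwinnertonDyer.Theorems.SignedKatoOffTwo.LocalAllPrimes
open Literature.NumberTheory.EllipticCurves Literature.NumberTheory.EllipticCurves.FormalGroupChart
open Literature.NumberTheory.GaloisRepresentations
open Literature.NumberTheory.EllipticCurves.Rank1Residual
open Literature.NumberTheory.EllipticCurves.ZpExtension Literature.NumberTheory.EllipticCurves.Kobayashi2003
open Summit.BirchSwinnertonDyer.BirchSwinnertonDyer.Theorems.SignedEC.PlusLayer

/-- The relative quotients `Stab ζ_{2^m} / Stab ζ_{2^{m+1}}` are finite. [folklore] -/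
theorem finite_stab_quot (m : ℕ) : Finite (stab 2 m ⧸ (stab 2 (m + 1)).subgroupOf (stab 2 m)) := by
  haveI : ((stab 2 (m + 1)).subgroupOf (stab 2 m)).FiniteIndex := by
    refine ⟨?_⟩
    rw [index_subgroupOf_stab_succ]
    split_ifs <;> norm_num
  exact Subgroup.finite_quotient_of_finiteIndex

/-- **The `ℤ₂`-tower points in Kobayashi's layer currency, with the construction displayed.** For `W/ℚ` globally minimal with
`GoodSS W 2` and `a₂(W) = 0`, the cyclotomic `κ` and ANY `ι : ℚ̄ → ℚ̄₂`: tower points `c_m` (`Λ(c_m) = ℓ_m`, on the model `M_W`),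
inverters `σ_m` and `d_n = 3 • (c_{n+2} + σ_{n+2} • c_{n+2}) − 2 • c_1` with (L) `d_m ∈ E(ℚ_{2,m})`, (TR)
`Tr_{m+2/m+1} d_{m+2} = −d_m` (the tree's `localTraceOfEmb`), (NONDIV) `d_0 ∉ 2·E(ℚ₂)`.
[cite: Kobayashi2003, Def. 1.1, Lemma 8.9, Prop. 8.12 (pp. 16–18)] [cite: Sprung2012, Thm. 2.2 (2′) (p. 1487)]
[cite: KuriharaOtsuki2006, §1.3, Prop. 1.4, p. 557] -/
theorem plusPointsLayer_two (W : WeierstrassCurve ℚ) [W.IsElliptic] [W.IsGloballyMinimal]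
    (hss : GoodSS W 2) (ha : W.frobeniusTrace 2 = 0) (κ : ZpExtension ℚ 2) (hκ : κ.IsCyclotomic)
    (ι : AlgebraicClosure ℚ →ₐ[ℚ] AlgebraicClosure ℚ_[2]) :
    ∃ (c : ℕ → localPoints W ℚ_[2]) (σ : ℕ → Field.absoluteGaloisGroup ℚ_[2]) (d : ℕ → localPoints W ℚ_[2]),
      (haveI := isIntegral_genFib_baseChange 2 ((integralModelInt W).map (Int.castRingHom ℤ_[2]))
        ∀ m, (toLoc ((genFibΩ_eq_baseChange ((integralModelInt W).map (Int.castRingHom ℤ_[2]))).trans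
              (baseChange_twoAdicModel W))).symm (c m) ∈
            subfieldPoints (genFibΩ 2 ((integralModelInt W).map (Int.castRingHom ℤ_[2]))) (layer 2 m).toSubfield
              coeffs_mem_layer ∧
          (toLoc ((genFibΩ_eq_baseChange ((integralModelInt W).map (Int.castRingHom ℤ_[2]))).trans
              (baseChange_twoAdicModel W))).symm (c m) ∈
            kernel (Valued.v (R := PadicAlgCl 2)) (genFibΩ 2 ((integralModelInt W).map (Int.castRingHom ℤ_[2]))) ∧
          ptLogΩ 2 ((integralModelInt W).map (Int.castRingHom ℤ_[2]))
            ((toLoc ((genFibΩ_eq_baseChange ((integralModelInt W).map (Int.castRingHom ℤ_[2]))).trans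
              (baseChange_twoAdicModel W))).symm (c m)) = ell 2 m) ∧
      (∀ m, ∀ τ ∈ stab 2 m, τ • c m = c m) ∧
      (∀ m, 1 ≤ m → σ m • zeta 2 m = (zeta 2 m)⁻¹) ∧
      (∀ n, d n = 3 • (c (n + 2) + σ (n + 2) • c (n + 2)) - 2 • c 1) ∧
      (∀ m, d m ∈ localLayerPointsOfEmb κ ι W m) ∧
      (∀ m, localTraceOfEmb κ ι W (m + 1) (m + 2) (d (m + 2)) = -d m) ∧
      (∀ b ∈ localLayerPointsOfEmb κ ι W 0, d 0 ≠ 2 • b) := by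
  haveI hFt : ∀ m, Fintype (stab 2 m ⧸ (stab 2 (m + 1)).subgroupOf (stab 2 m)) := fun m =>
    haveI := finite_stab_quot m; Fintype.ofFinite _
  obtain ⟨c, σ, d, hcΩ, hcstab, hσ, hd, hdstab, hdinv, htr, hnd⟩ := exists_plusPoints_two_of_goodSS W hss ha
  have hL : ∀ m, d m ∈ localLayerPointsOfEmb κ ι W m := fun m =>
    (mem_localLayerPointsOfEmb_two_iff_stab W ι hκ (hσ (m + 2) (by omega)) (d m)).mpr
      ⟨hdstab m, hdinv m (σ (m + 2)) (hσ (m + 2) (by omega))⟩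
  refine ⟨c, σ, d, hcΩ, hcstab, hσ, hd, hL, fun m => ?_, fun b hb => hnd b ((mem_localLayerPointsOfEmb_zero_iff κ ι W b).mp hb)⟩
  rw [localTraceOfEmb_two_eq_sum_stab ι W hκ (by omega : m + 1 ≤ m + 2) (hL (m + 2))]
  convert htr m using 2

/-- **(L) ∧ (TR) ∧ (NONDIV) of the plus Honda system at `2`, clause form**: for `W/ℚ` globally minimal with `GoodSS W 2`,
`a₂(W) = 0`, the cyclotomic `κ` and every `ι : ℚ̄ → ℚ̄₂` there is `d : ℕ → localPoints W ℚ_[2]` with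
`∀ m, d m ∈ localLayerPointsOfEmb κ ι W m`, `∀ m, localTraceOfEmb κ ι W (m+1) (m+2) (d (m+2)) = −d m` and
`∀ b ∈ localLayerPointsOfEmb κ ι W 0, d 0 ≠ 2 • b` — three of the four clauses of the hypothesis of
`SignedEC.stub_plusHondaSystemTwo_of_padic_nonDiv` VERBATIM (the fourth, (GEN) for `m ≥ 1`, is Prop. 8.11⁺/the tower lemma).
[cite: Kobayashi2003, Def. 1.1, Lemma 8.9, Prop. 8.12 (pp. 16–18)] [cite: Sprung2012, Thm. 2.2 (2′) (p. 1487)] -/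
theorem plusPointsLayer_two_clauses (W : WeierstrassCurve ℚ) [W.IsElliptic] [W.IsGloballyMinimal]
    (hss : GoodSS W 2) (ha : W.frobeniusTrace 2 = 0) (κ : ZpExtension ℚ 2) (hκ : κ.IsCyclotomic)
    (ι : AlgebraicClosure ℚ →ₐ[ℚ] AlgebraicClosure ℚ_[2]) :
    ∃ d : ℕ → localPoints W ℚ_[2],
      (∀ m, d m ∈ localLayerPointsOfEmb κ ι W m) ∧
      (∀ m, localTraceOfEmb κ ι W (m + 1) (m + 2) (d (m + 2)) = -d m) ∧
      (∀ b ∈ localLayerPointsOfEmb κ ι W 0, d 0 ≠ 2 • b) := by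
  obtain ⟨-, -, d, -, -, -, -, hL, hTR, hND⟩ := plusPointsLayer_two W hss ha κ hκ ι
  exact ⟨d, hL, hTR, hND⟩

end SignedKatoOffTwo.LocalTwo

end Summit.BirchSwinnertonDyer.BirchSwinnertonDyer.Theorems

end
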